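import Summits.CriticalPhenomena.PercolationContinuityZ3.Theorems.Transplant.SkelFrmBChoiceRootRunY
import HarnessLib

/-!
# N2 (frames-only node `SamePDropOfSkeletonFrm₁`, OPEN), (R) column SECOND axis — **THE ROOT y′-ARRIVAL BOX AGAINST (C)'s, ACROSS** and the
# frame shift to the anchor: `Skelφ.runX_shift_mem_Icc` (cell-free: a box in the frame at a lattice point `c` on `t`'s shear line, residue
# `r ∈ [0, U)`, is the box shifted by `(X, 0…1)` in the anchor frame at `t`), `KS.rootBoxY_across_R` (the root's arrival box across coordinates,
# shifted by `X2R`, lie within `(C)`'s `± 2·n_L`: `arrLo₀^C − 2n_L ≤ X2R + lo₀^R` and `X2R + hi₀^R ≤ arrHi₀^C + n_L`, from the creep matching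
# `ctr2Y_R_le/le_ctr2Y_R` and the spread `hw2Y_R_le`), `KS.rootBoxY_top_R` (along top: `hi₁^R ≤ hi₁^C`).  The along bottom (`lo₁^R ≥ lo₁^C − sL`,
# i.e. `XY^C − XY^R ≤ sL`) follows in the next file (needs the `m₂Y` ceiling-difference lemma).
Consumers: stmt's `hLtY_W_box/hLlY_W_box` (SkelFrmBChoiceCreepYWBox) with `B := [lo + (X2R, 0), hi + (X2R, 1)]`, then hp-8's RootRoomsV reading
for the skeleton's `hlastf` (second axis).
builds on p205010 (kernel theorem, internal audit signed; external expert review pending) — nothing in this file uses p205010; nothing here is a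
claim about the open node `SamePDropOfSkeletonFrm₁`.
Lane `prim-bschramm`, seat `prim-bschramm-p3` (gen 17; (R) lineage); helper file (`--supports stmt-CriticalPhenomena-4575 --as helper`).
[cite: KozmaNitzan2024, §4 Lemma 12 (pp. 23–25: the target box)]
-/

noncomputable section

open scoped Classical

namespace Summit.CriticalPhenomena.PercolationContinuityZ3.Theorems.Transplant

namespace Skelφ

open Literature.Probability.Percolation Literature.Probability.LatticeModels SimpleGraph

section Shift

variable {V : Type} {φ : V → Site 2}

/-- **FRAME SHIFT TO THE ANCHOR**: if `φ c − φ t = (X, Y)` with `0 ≤ n·Y − h·X < U` (`c` on `t`'s shear line), a point whose `c`-frame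
coordinates `runX φ c n h 1` lie in `[lo, hi]` has `t`-frame coordinates in `[lo + (X, 0), hi + (X, 1)]` (x′ exact, rows up by at most one).
[folklore] -/
theorem runX_shift_mem_Icc (t c : V) (n : ℕ) (hn : 1 ≤ n) (h : ℤ) {X Y : ℤ} (hX : φ c 0 - φ t 0 = X) (hY : φ c 1 - φ t 1 = Y)
    (hr0 : 0 ≤ (n : ℤ) * Y - h * X) (hrU : (n : ℤ) * Y - h * X < (shearUnit n h : ℤ))
    {lo hi : Site 2} {w : V} (hw : runX φ c n h 1 w ∈ Finset.Icc lo hi) :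
    runX φ t n h 1 w ∈ Finset.Icc (lo + ![X, 0]) (hi + ![X, 1]) := by
  have hU : (0 : ℤ) < (shearUnit n h : ℤ) := shearUnit_pos hn h
  rw [Finset.mem_Icc, Pi.le_def, Pi.le_def, Fin.forall_fin_two, Fin.forall_fin_two] at hw ⊢
  obtain ⟨⟨h0, h1⟩, h2, h3⟩ := hw
  simp only [runX_zero, runX_one, shearCoord_apply, relCoord, one_mul, Pi.add_apply, Matrix.cons_val_zero, Matrix.cons_val_one,
    Matrix.cons_val_fin_one] at h0 h1 h2 h3 ⊢
  have eS : (n : ℤ) * (φ w 1 - φ t 1) - h * (φ w 0 - φ t 0) = ((n : ℤ) * (φ w 1 - φ c 1) - h * (φ w 0 - φ c 0)) + ((n : ℤ) * Y - h * X) := by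
    rw [← hX, ← hY]; ring
  set S := (n : ℤ) * (φ w 1 - φ c 1) - h * (φ w 0 - φ c 0) with hS
  set r := (n : ℤ) * Y - h * X with hr
  have hlo : S / (shearUnit n h : ℤ) ≤ (S + r) / (shearUnit n h : ℤ) := Int.ediv_le_ediv hU (by linarith)
  have hhi : (S + r) / (shearUnit n h : ℤ) ≤ S / (shearUnit n h : ℤ) + 1 := by
    have : (S + r) / (shearUnit n h : ℤ) ≤ (S + 1 * (shearUnit n h : ℤ)) / (shearUnit n h : ℤ) := Int.ediv_le_ediv hU (by linarith)
    rwa [Int.add_mul_ediv_right _ _ (ne_of_gt hU)] at this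
  rw [eS]
  refine ⟨⟨by linarith, by linarith⟩, by linarith, by linarith⟩

end Shift

end Skelφ

namespace PlanarSkeletonFrm

namespace NegB

open Literature.Probability.Percolation Literature.Probability.LatticeModels SimpleGraph
open SkelConc (Consts)
open Skelφ (shearUnit kgSL kgSLY KGYRows kgXY kgM₁Y kgM₂Y kgCtr2Y kgHw2Y kgDec₁Y)
open Neg

namespace KS

section BoxY

variable (κ : Consts) {V : Type} [DecidableEq V] [Countable V] {G : SimpleGraph V} [G.LocallyFinite] (Φ : PlanarSkeletonFrm G) (t : V) (p : unitInterval)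
  (D : Skelφ.StepI.DataNS V) (mk g f qxY WxY : ℕ)

/-- **ACROSS CONTAINMENT**: the root's y′-arrival box across corners, shifted by `X2R`, satisfy `arrLo₀^C − 2·n_L ≤ X2R + lo₀^R` and
`X2R + hi₀^R ≤ arrHi₀^C + n_L` (`2X2R + Ctr2^R ∈ [Ctr2^C − (n_L + dec₁Y − 1), Ctr2^C + dec₁Y − 1]`, `Hw2^R ≤ Hw2^C + dec₁Y − 1`, `dec₁Y ≤ n_L`).
[this work] -/
theorem rootBoxY_across_R (hN : EqNumL κ Φ t p D g f) (hg : gFloorKG κ Φ t p D mk ≤ g) (hg2 : 40 * Neg.K κ * KS0.R'0 κ Φ t p D mk ≤ g)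
    (hWxY : KS.Rs t D mk + 34 * nL κ Φ t p D g f + 29 * KS0.R'0 κ Φ t p D mk + 2 ≤ WxY) (hWx : WxY ≤ 100 * nL κ Φ t p D g f) :
    ((kgYRows0_of κ Φ t p D g f mk qxY WxY hN hg).kgLastLoY (kgNYv0 κ Φ t p D g f mk qxY WxY)) 0 - 2 * (nL κ Φ t p D g f : ℤ) ≤ (((KS.X2R κ Φ t p D mk g f WxY) : ℕ) : ℤ) + ((kgYRows0_of κ Φ t p D g f mk qxY (KS.WxYR κ Φ t p D mk g f WxY) hN hg).kgLastLoY (kgNYv0 κ Φ t p D g f mk qxY WxY)) 0 ∧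
    (((KS.X2R κ Φ t p D mk g f WxY) : ℕ) : ℤ) + ((kgYRows0_of κ Φ t p D g f mk qxY (KS.WxYR κ Φ t p D mk g f WxY) hN hg).kgLastHiY (kgNYv0 κ Φ t p D g f mk qxY WxY)) 0 ≤ ((kgYRows0_of κ Φ t p D g f mk qxY WxY hN hg).kgLastHiY (kgNYv0 κ Φ t p D g f mk qxY WxY)) 0 + (nL κ Φ t p D g f : ℤ) := by
  have hup := ctr2Y_R_le κ Φ t p D mk g f WxY hN hg hg2 hWxY hWx (kgNYv0 κ Φ t p D g f mk qxY WxY)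
  have hlo := le_ctr2Y_R κ Φ t p D mk g f WxY hN hg hWxY (kgNYv0 κ Φ t p D g f mk qxY WxY)
  have hhw := hw2Y_R_le κ Φ t p D mk g f qxY WxY hN hg (kgNYv0 κ Φ t p D g f mk qxY WxY)
  have hd : (kgDec₁Y (nL κ Φ t p D g f) (kgR κ Φ t p D mk) 0) ≤ (nL κ Φ t p D g f : ℤ) := by
    unfold kgDec₁Y; have : (0 : ℤ) ≤ (((kgR κ Φ t p D mk) : ℕ) : ℤ) := by positivity
    push_cast; linarith
  have hd1 : 1 ≤ (kgDec₁Y (nL κ Φ t p D g f) (kgR κ Φ t p D mk) 0) := by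
    have := (kgYRows0_of κ Φ t p D g f mk qxY (KS.WxYR κ Φ t p D mk g f WxY) hN hg).dec₁_pos.1
    have : (0 : ℤ) ≤ (((kgR κ Φ t p D mk) : ℕ) : ℤ) := by positivity
    push_cast at *; linarith
  have hhw0 : 0 ≤ (kgHw2Y (nL κ Φ t p D g f) (ℓL κ Φ t p D g f) (hL κ Φ t p D g f) (vL κ Φ t p D g f) (kgR κ Φ t p D mk) 0 (kgqY κ Φ t p D g f qxY) (kgWY κ Φ t p D g f (KS.WxYR κ Φ t p D mk g f WxY)) (kgNYv0 κ Φ t p D g f mk qxY WxY)) := by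
    unfold kgHw2Y
    have : (0 : ℤ) ≤ (((kgR κ Φ t p D mk) : ℕ) : ℤ) := by positivity
    have : (0 : ℤ) ≤ |(vL κ Φ t p D g f)| := abs_nonneg _
    positivity
  simp only [KGYRows.kgLastLoY, KGYRows.kgLastHiY, Matrix.cons_val_zero]
  constructor <;> omega

/-- **ALONG TOP**: the root's y′-arrival far edge is at most (C)'s (`XY^R ≤ XY^C`). [this work] -/
theorem rootBoxY_top_R (hN : EqNumL κ Φ t p D g f) (hg : gFloorKG κ Φ t p D mk ≤ g) :
    ((kgYRows0_of κ Φ t p D g f mk qxY (KS.WxYR κ Φ t p D mk g f WxY) hN hg).kgLastHiY (kgNYv0 κ Φ t p D g f mk qxY WxY)) 1 ≤ ((kgYRows0_of κ Φ t p D g f mk qxY WxY hN hg).kgLastHiY (kgNYv0 κ Φ t p D g f mk qxY WxY)) 1 := by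
  have hmono := (kgYRows0_of κ Φ t p D g f mk qxY (KS.WxYR κ Φ t p D mk g f WxY) hN hg).kgXY_mono_qW le_rfl (kgWY_R_le κ Φ t p D mk g f WxY) (kgNYv0 κ Φ t p D g f mk qxY WxY)
  simp only [KGYRows.kgLastHiY, Matrix.cons_val_one, Matrix.cons_val_zero]
  linarith

end BoxY

end KS

end NegB

end PlanarSkeletonFrm

end Summit.CriticalPhenomena.PercolationContinuityZ3.Theorems.Transplant

end
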